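import Summits.Ventures.YMGap.RobustBall.IsingLayerBox
import Summits.Ventures.YMGap.RobustBall.CentreBlindStarWindow
import Literature.Probability.LatticeModels.PlanarIsingCriticalBeta
import HarnessLib

/-!
# RobustBall/CentreBlindSubcritical — RUNG ∞ OF THE `β`-LADDER: `AreaLawCentreBlind 2 d β` for `SU(2)` whenever the `(d−1)`-dimensional Ising model at
# `β_W = 2|β|` is SUBCRITICAL (`β_W < β_c(ℤ^{d−1})`); `d = 3`: `β_W < ½ log(1+√2) = 0.44068…` (rung 3: `0.32696`); `d = 4`: `β_W < β_c(ℤ³)`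

HONEST FRAMING: venture file of the cell `pub-ymgap` (QuantumFields programme), track Y2 ROBUST-BALL / DS seat ds-4 (g11).  WHAT THIS IS: a
strong-coupling LATTICE theorem — Wilson's area law `|⟨W_{R×T}⟩_{β,W,L}| ≤ C^{2(R+T)} e^{−cRT}` with ONE pair `(C, c)` on every torus `(ℤ/L)^d`, for
`SU(2)` and EVERY LINKWISE CENTRE-BLIND perturbation `W` (gen 7's countersigned currency `AreaLawCentreBlind 2 d β`, ROBUST-BALL-STATEMENT §6(c)), now on
the WHOLE SUBCRITICAL REGIME OF THE LAYER: **`su2_areaLawCentreBlind_of_lt_criticalBeta`**: `2 ≤ n → 2|β| < β_c(ℤⁿ) → AreaLawCentreBlind 2 (n+1) β`,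
where `β_c(ℤⁿ) = criticalBeta n` is the critical inverse temperature of the nearest-neighbour Ising model (`IsingThermodynamics`).  The ladder so far:
rung 1 (Dobrushin, gen 7) `2(d−1)β_W < 1`; rung 2 (stars, gen 9) `2(d−1)(2d−3)tanh²β_W < 1`; rung 3 (radius-2 balls, gen 10) `d = 4`: `tanh β_W ≤ 23/120`,
`d = 3`: `tanh β_W ≤ 6/19`; all three are finite-set certificates `φ_β(S) < 1` of Duminil-Copin–Tassion type, and DCT's sharpness theorem says such a
certificate EXISTS (with `S` a box `Λ_R`) at every `β < β_c` — which is the tree's `exists_dctIsingPhi_box_lt_one_of_lt_criticalBeta` (standard axioms).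
So this file CLOSES the ladder at its ceiling: the ferromagnetic-comparison method cannot pass `β_c(ℤ^{d−1})` (the comparison Ising model then has long-range
order), and it now reaches it.  ROWS: `d = 3`: **`su2_areaLawCentreBlind_subcritical_dim3`**: `2|β| < log(1+√2)/2 → AreaLawCentreBlind 2 3 β` via the tree's
`criticalBeta_two_holds` (`β_c(ℤ²) = ½log(1+√2)`, Onsager–Kaufman / Aizenman–Barsky–Fernández, kernel theorem), i.e. `β_W < 0.440686…` (rung 3: `0.32696`),
cells `β_W = 2/5` and `β_W = 11/25 = 0.44`; `d = 4`: **`su2_areaLawCentreBlind_subcritical_dim4`**: `2|β| < criticalBeta 3 → AreaLawCentreBlind 2 4 β`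
(`β_c(ℤ³) ≈ 0.2217` numerically; NO closed form and no explicit lower bound beyond the rung certificates is in the tree, so the explicit `d = 4` cells remain
rung 3's `β_W ≤ 0.194`: the remaining gap is a question about explicit lower bounds on `β_c(ℤ³ Ising)` alone).  DOOR: **`su2_areaLawCentreBlind_of_dctIsingPhi_lt_one`**:
ANY box certificate `φ_{β_W}(Λ_R) < 1` in dimension `d − 1` gives the area law (certificate → row, final form); and its CEILING
**`one_le_dctIsingPhi_of_criticalBeta_le`**: for `β_W ≥ β_c(ℤⁿ)` no finite set has a certificate (`φ_{β_W}(S) ≥ 1`, DCT's `β̃_c = β_c`).  MECHANISM: centre projection (Fröhlich 1979 /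
Mack–Petkova 1979, gen 7) + block conditioning (gen 8) reduce the loop to rung two-point functions of the `ℤ₂` layer, an Ising model on the layer graph with
couplings `|J| ≤ β_W`, bounded by the FERROMAGNET at `β_W` (Griffiths; `ZTwoLayerIsing`/`ZTwoLayerGraph`, gen 9); the layer two-point function is bounded by
`φ_{β_W}(Λ_R)^{⌊T/(R+1)⌋}` (`IsingLayerBox`: gen 9's Simon–Lieb engine fed with the DCT boxes embedded in each layer, `L ≥ 2R+3`); small tori are trivial.
HONEST LABEL: `SU(2)` only (the `ℤ₂` layer is an Ising model); centre-blind class only (no tube); the constants `(C, c)` are NOT explicit in `β` (they come from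
DCT's box, whose size is not controlled); the true end of the centre-blind window is the `ℤ₂`-gauge deconfinement transition (`d = 4`: `β_W ≈ 0.44`;
`d = 3`: `β_W ≈ 0.7614`, dual of `β_c(ℤ³)`), which this comparison method cannot see; nothing continuum / spectral / Clay.

References AS PRINTED: J. Fröhlich, Phys. Lett. B 83 (1979) 195; G. Mack, V. B. Petkova, Ann. Phys. 123 (1979) 442; H. Duminil-Copin, V. Tassion,
Comm. Math. Phys. 343 (2016) 725, Thm. 1.2 / Lemma 2.7 / §2.5; M. Aizenman, D. Barsky, R. Fernández, J. Stat. Phys. 47 (1987) 343; R. Griffiths,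
J. Math. Phys. 8 (1967) 478; L. Onsager, Phys. Rev. 65 (1944) 117.
-/

noncomputable section

open Finset MeasureTheory
open Literature.MathematicalPhysics.QuantumLattice (fundamentalRep)
open Literature.MathematicalPhysics.QuantumFieldTheory
open Literature.Probability.LatticeModels (dctIsingPhi box criticalBeta criticalBetaTwo)

namespace Summit.Ventures.YMGap.RobustBall

open ZN ZNFluxW ZTwo

variable {n L : ℕ} [NeZero L]

/-! ### From a box certificate to the loop bound -/

/-- **TWO-POINT BOUND OF THE CENTRE-PROJECTED `ℤ₂` LAYER FROM A DCT BOX** (`L ≥ 2R+3`, no twist defect): for every selected set `H`, transverse `kT`,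
frozen `κ`, background `U` and sites `b, t`: `‖E ψ₂(σ_b − σ_t)‖ ≤ φ_{2|β|}(Λ_R)^{⌊dist_j(t,b)/(R+1)⌋}`. [folklore] -/
theorem norm_cavg_ψ_two_le_dctIsingPhi_pow {R : ℕ} (hRL : 2 * R + 3 ≤ L) (β : ℝ)
    (gD : Fin 0 → (Plaquette (n + 1) L → ZMod 2) → GaugeConfig (n + 1) L (SUN 2) → ℝ) (U : GaugeConfig (n + 1) L (SUN 2)) (i j : Fin (n + 1))
    (H : Finset (ZMod L)) (kT : Transverse (n + 1) L (ZMod 2) i) (κ : Site (n + 1) L → ZMod 2) (b t : Site (n + 1) L) :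
    ‖FiniteGibbs.cavg (layerWeightW (gS β gD U) i H kT κ) (fun σ => ψ 2 (σ b - σ t))‖ ≤
      dctIsingPhi n (2 * |β|) (box n R) ^ (jDist j t b / (R + 1)) := by
  classical
  refine (norm_cavg_ψ_two_le_gksExpect_const (by omega) β gD U i H kT κ b t).trans ?_
  rw [gksExpect_const_eq_isingTwoPoint (by omega)]
  exact isingTwoPoint_layer_le_dctIsingPhi_pow (by positivity) (by omega) i j H t (jDist j t b / (R + 1)) b (Nat.mul_div_le _ _)

/-- **The induced `ℤ₂` Wilson loop (no twist defect) obeys the box-certificate bound** (`L ≥ 2R+3`, `i ≠ j`, `2R', 2T ≤ L`):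
`‖znLoopW‖ ≤ (φ^{⌊T/(R+1)⌋})^{#selIdx 1 R'}`. [folklore] -/
theorem norm_znLoopW_le_dctIsingPhi {R : ℕ} (hRL : 2 * R + 3 ≤ L) (β : ℝ)
    (gD : Fin 0 → (Plaquette (n + 1) L → ZMod 2) → GaugeConfig (n + 1) L (SUN 2) → ℝ) (U : GaugeConfig (n + 1) L (SUN 2)) (x : Site (n + 1) L)
    {i j : Fin (n + 1)} (hij : i ≠ j) {R' T : ℕ} (hR : 2 * R' ≤ L) (hT : 2 * T ≤ L) :
    ‖znLoopW β gD U x i j R' T‖ ≤ (dctIsingPhi n (2 * |β|) (box n R) ^ (T / (R + 1))) ^ (selIdx 1 R').card := by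
  classical
  unfold znLoopW
  refine norm_cavg_ψ_loopSum_le_of_bound (supp := suppS (fun _ : Fin 0 => (∅ : Finset (Plaquette (n + 1) L)))) (g := gS β gD U)
    ?_ hij (m := 1) ?_ (F := fun D => dctIsingPhi n (2 * |β|) (box n R) ^ (D / (R + 1))) (fun H kT κ b t => ?_) x hR hT
  · rintro (p | t)
    · intro φ φ' h
      simp only [gS, Sum.elim_inl]
      rw [h p (by simp [suppS])]
    · exact Fin.elim0 t
  · rintro (p | t) y hy y' hy'
    · simp only [suppS, Sum.elim_inl, iLinks_singleton] at hy hy'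
      rw [iDist_eq_zero_of_mem_iSites i p hy hy']; exact Nat.one_pos
    · exact Fin.elim0 t
  · exact norm_cavg_ψ_two_le_dctIsingPhi_pow hRL β gD U i j H kT κ b t

/-- **CENTRE PROJECTION + BOX CERTIFICATE** (`SU(2)`, `L ≥ 2R+3`): for EVERY twist-blind `W` and every non-wrapping `R' × T` loop,
`|⟨(1/2) tr U_{R'×T}⟩_{β,W,L}| ≤ (φ_{2|β|}(Λ_R)^{⌊T/(R+1)⌋})^{#selIdx 1 R'}`. [cite: Frohlich1979ZN, Eq. (7)–(9)] -/
theorem abs_wilsonLoop_le_dctIsingPhi {R : ℕ} (hRL : 2 * R + 3 ≤ L) {β : ℝ} (W : Perturbation (n + 1) L 2) (hW : IsTwistBlind W)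
    (x : Site (n + 1) L) {i j : Fin (n + 1)} (hij : i ≠ j) {R' T : ℕ} (hR : 2 * R' ≤ L) (hT : 2 * T ≤ L) :
    |W.expectation (fundamentalRep (Fin 2)) β (wilsonLoop (fundamentalRep (Fin 2)) x i j R' T)| ≤
      (dctIsingPhi n (2 * |β|) (box n R) ^ (T / (R + 1))) ^ (selIdx 1 R').card :=
  abs_expectation_wilsonLoop_le_of_fluxDefect W (c := W.total) (gD := fun (_ : Fin 0) _ _ => (0 : ℝ))
    (fun k U => by rw [hW k U]; simp) β x i j R' T fun U => norm_znLoopW_le_dctIsingPhi hRL β _ U x hij hR hT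

/-- The area-law normal form of a radius-`R` ladder bound: for `0 < c₀ ≤ 1`, `c = −log c₀/(R+1)`, `C = e^{c(R+1)/2}`,
`(c₀^{⌊T/(R+1)⌋})^{R'} ≤ C^{2(R'+T)} · e^{−c R'T}`. [folklore] -/
theorem boxShape {c₀ : ℝ} (hc0 : 0 < c₀) (hc1 : c₀ ≤ 1) (R R' T : ℕ) :
    (c₀ ^ (T / (R + 1))) ^ R' ≤
      Real.exp (-Real.log c₀ / (R + 1) * (R + 1) / 2) ^ (2 * (R' + T)) * Real.exp (-(-Real.log c₀ / (R + 1)) * ((R' : ℝ) * T)) := by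
  set c := -Real.log c₀ / (R + 1) with hc
  have hR1 : (0 : ℝ) < R + 1 := by positivity
  have hcnn : 0 ≤ c := div_nonneg (neg_nonneg.2 (Real.log_nonpos hc0.le hc1)) hR1.le
  have hlog : Real.log c₀ = -(R + 1) * c := by rw [hc]; field_simp
  rw [← Real.rpow_natCast c₀, ← Real.rpow_natCast, ← Real.rpow_mul hc0.le, Real.rpow_def_of_pos hc0, ← Real.exp_nat_mul,
    ← Real.exp_add]
  apply Real.exp_le_exp.2
  have hq : ((T : ℝ) - R) ≤ (R + 1) * ((T / (R + 1) : ℕ) : ℝ) := by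
    have : T ≤ (R + 1) * (T / (R + 1)) + R := by
      have h1 := Nat.div_add_mod T (R + 1)
      have h2 := Nat.mod_lt T (show 0 < R + 1 by omega)
      omega
    have : (T : ℝ) ≤ (R + 1 : ℝ) * ((T / (R + 1) : ℕ) : ℝ) + R := by exact_mod_cast this
    linarith
  rw [hlog]
  push_cast
  have hR0 : (0 : ℝ) ≤ R' := Nat.cast_nonneg R'
  have hT0 : (0 : ℝ) ≤ T := Nat.cast_nonneg T
  have hRR : (0 : ℝ) ≤ R := Nat.cast_nonneg R
  have hn0 : (0 : ℝ) ≤ ((T / (R + 1) : ℕ) : ℝ) := Nat.cast_nonneg _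
  have key : -(R + 1 : ℝ) * c * ((T / (R + 1) : ℕ) : ℝ) * R' ≤ -c * ((T : ℝ) - R) * R' := by
    have := mul_le_mul_of_nonneg_left hq (mul_nonneg hcnn hR0)
    nlinarith
  have hfin : -c * ((T : ℝ) - R) * R' ≤ c * (R + 1) / 2 * (2 * (R' + T)) + -c * (R' * T) := by
    nlinarith [mul_nonneg hcnn hR0, mul_nonneg hcnn hT0, mul_nonneg (mul_nonneg hcnn hR0) hRR, mul_nonneg (mul_nonneg hcnn hT0) hRR]
  linarith [key, hfin]

/-- **CERTIFICATE → ROW, FINAL FORM: `AreaLawCentreBlind 2 (n+1) β` from ANY Duminil-Copin–Tassion box certificate `φ_{2|β|}(Λ_R) < 1` in dimension `n`.**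
Wilson's area law with ONE `(C, c)` (`c = −log max(φ, 1/2)/(R+1)`, `C = e^{c(R+1)/2}`) for `SU(2)` in `d = n + 1` dimensions plus EVERY linkwise
centre-blind perturbation on every torus. [cite: MackPetkova1979, §2] -/
theorem su2_areaLawCentreBlind_of_dctIsingPhi_lt_one {β : ℝ} {R : ℕ} (hφ : dctIsingPhi n (2 * |β|) (box n R) < 1) :
    AreaLawCentreBlind 2 (n + 1) β := by
  have hφnn : 0 ≤ dctIsingPhi n (2 * |β|) (box n R) :=
    Literature.Probability.LatticeModels.dctIsingPhi_nonneg
      (fun {_ _ _ _ _} => Literature.Probability.LatticeModels.GriffithsKellySherman.gks_one_holds (Literature.Probability.LatticeModels.zdGraph n))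
      (by positivity) (Literature.Probability.LatticeModels.zero_mem_box n R)
  set φ := dctIsingPhi n (2 * |β|) (box n R) with hφdef
  set c₀ := max φ (1 / 2) with hc₀
  have hc0 : 0 < c₀ := lt_max_of_lt_right (by norm_num)
  have hc1 : c₀ < 1 := max_lt hφ (by norm_num)
  have hφle : φ ≤ c₀ := le_max_left _ _
  set c := -Real.log c₀ / (R + 1) with hc
  have hR1 : (0 : ℝ) < R + 1 := by positivity
  have hcpos : 0 < c := div_pos (neg_pos.2 (Real.log_neg hc0 hc1)) hR1
  set C := Real.exp (c * (R + 1) / 2) with hC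
  refine ⟨C, c, hcpos, fun L _ W hW x i j R' T hij hR1' hT1 hRL hTL => ?_⟩
  have hWt : IsTwistBlind W := hW.isTwistBlind
  by_cases hL : 2 * R + 3 ≤ L
  · refine (abs_wilsonLoop_le_dctIsingPhi hL W hWt x hij hRL hTL).trans ?_
    have h1 : (φ ^ (T / (R + 1))) ^ (selIdx 1 R').card ≤ (c₀ ^ (T / (R + 1))) ^ (selIdx 1 R').card :=
      pow_le_pow_left₀ (pow_nonneg hφnn _) (pow_le_pow_left₀ hφnn hφle _) _
    have h2 : (c₀ ^ (T / (R + 1))) ^ (selIdx 1 R').card ≤ (c₀ ^ (T / (R + 1))) ^ R' :=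
      pow_le_pow_of_le_one (pow_nonneg hc0.le _) (pow_le_one₀ hc0.le hc1.le) (by simpa using le_mul_card_selIdx Nat.one_pos R')
    refine h1.trans (h2.trans ?_)
    have h3 := boxShape hc0 hc1.le R R' T
    have hCe : Real.exp (-Real.log c₀ / (R + 1) * (R + 1) / 2) = C := by rw [hC, hc]
    rw [hCe, ← hc] at h3
    exact h3
  · -- small torus: `R', T ≤ R + 1`, the loop is bounded by `1 ≤ C^{2(R'+T)} e^{−c R'T}`
    have hR' : R' ≤ R + 1 := by omega
    have hT' : T ≤ R + 1 := by omega
    refine (abs_expectation_wilsonLoop_le_one W β x i j R' T).trans ?_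
    rw [hC, ← Real.exp_nat_mul, ← Real.exp_add]
    refine Real.one_le_exp ?_
    push_cast
    have hR'r : (R' : ℝ) ≤ R + 1 := by exact_mod_cast hR'
    have hR0 : (0 : ℝ) ≤ R' := Nat.cast_nonneg R'
    have hT0 : (0 : ℝ) ≤ T := Nat.cast_nonneg T
    nlinarith [mul_nonneg hcpos.le hR0, mul_nonneg hcpos.le hT0, mul_nonneg (mul_nonneg hcpos.le hT0) (sub_nonneg.2 hR'r)]

/-- **RUNG ∞ — THE SUBCRITICAL-LAYER THEOREM: `AreaLawCentreBlind 2 (n+1) β` whenever `2|β| < β_c(ℤⁿ)`** (`n ≥ 2`): Wilson's area law with ONE `(C, c)` for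
`SU(2)` in `d = n + 1 ≥ 3` dimensions plus EVERY linkwise centre-blind perturbation on every torus, on the whole subcritical regime of the `n`-dimensional
Ising model at `β_W = 2|β|` (Duminil-Copin–Tassion sharpness supplies the box certificate). [cite: DuminilCopinTassionCMP2016, Thm. 1.2 and §2.1 (β̃_c = β_c)] -/
theorem su2_areaLawCentreBlind_of_lt_criticalBeta (hn : 2 ≤ n) {β : ℝ} (hβ : 2 * |β| < criticalBeta n) : AreaLawCentreBlind 2 (n + 1) β := by
  obtain ⟨R, -, hφ⟩ := Literature.Probability.LatticeModels.exists_dctIsingPhi_box_lt_one_of_lt_criticalBeta hn (by positivity) hβ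
  exact su2_areaLawCentreBlind_of_dctIsingPhi_lt_one hφ

/-- **THE DOOR CANNOT OPEN ABOVE `β_c` — the certificate method's ceiling** (Duminil-Copin–Tassion 2016, Thm. 1.2: `β̃_c = β_c`): for `n ≥ 2` and
`β_W = 2|β| ≥ β_c(ℤⁿ)`, EVERY finite `S ∋ 0` (stars, balls, boxes, …) has `φ_{β_W}(S) ≥ 1`.  A certificate `< 1` would give exponential decay of the
free two-point function (the tree's `twoPointFree_exp_decay_of_dctIsingPhi_lt_one`), hence finite susceptibility, contradicting `χ = ∞` on `[β_c, ∞)`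
(`susceptibility_eq_top_of_criticalBeta_le`).  So rungs 1, 2, 3, ∞ — all Duminil-Copin–Tassion certificates — stop exactly at `β_c(ℤ^{d−1})`.
[cite: DuminilCopinTassionCMP2016, Thm. 1.2 (β̃_c = β_c)] -/
theorem one_le_dctIsingPhi_of_criticalBeta_le (hn : 2 ≤ n) {β : ℝ} (hβ : criticalBeta n ≤ 2 * |β|) {S : Finset (Fin n → ℤ)}
    (h0 : (0 : Fin n → ℤ) ∈ S) : 1 ≤ dctIsingPhi n (2 * |β|) S := by
  by_contra hlt
  rw [not_le] at hlt
  have hpos : 0 < 2 * |β| := lt_of_lt_of_le (Literature.Probability.LatticeModels.criticalBeta_pos_holds hn) hβ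
  have hgks : ∀ {Λ A : Finset (Fin n → ℤ)} {β h : ℝ} {bc : Literature.Probability.LatticeModels.BoundaryCondition (Fin n → ℤ)},
      Literature.Probability.LatticeModels.gks_one (Literature.Probability.LatticeModels.zdGraph n) (Λ := Λ) (A := A) (β := β) (h := h) (bc := bc) :=
    Literature.Probability.LatticeModels.GriffithsKellySherman.gks_one_holds (Literature.Probability.LatticeModels.zdGraph n)
  obtain ⟨c, hc, hdec⟩ := Literature.Probability.LatticeModels.twoPointFree_exp_decay_of_dctIsingPhi_lt_one
    Literature.Probability.LatticeModels.dct_modifiedSimon_finiteVolume_holds Literature.Probability.LatticeModels.isingTwoPoint_free_translate_holds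
    hgks Literature.Probability.LatticeModels.hasBoxLimit_isingCorr_free_holds Literature.Probability.LatticeModels.isingCorr_free_mono_volume_holds
    hpos h0 hlt
  obtain ⟨B, hB⟩ := Literature.Probability.LatticeModels.sum_box_exp_neg_mul_norm_le (d := n) hc
  have hG0 : ∀ y, 0 ≤ Literature.Probability.LatticeModels.twoPointFree n (2 * |β|) y := fun y =>
    Literature.Probability.LatticeModels.twoPointFree_nonneg Literature.Probability.LatticeModels.hasBoxLimit_isingCorr_free_holds hgks hpos.le y
  have hχ : Literature.Probability.LatticeModels.susceptibility n (2 * |β|) ≤ ENNReal.ofReal B := by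
    rw [Literature.Probability.LatticeModels.susceptibility_eq_iSup_box_sum]
    refine iSup_le fun L => ?_
    rw [← ENNReal.ofReal_sum_of_nonneg fun y _ => hG0 y]
    exact ENNReal.ofReal_le_ofReal ((Finset.sum_le_sum fun y _ => hdec y).trans (hB L))
  rw [Literature.Probability.LatticeModels.susceptibility_eq_top_of_criticalBeta_le hn hβ] at hχ
  exact ENNReal.top_ne_ofReal (le_antisymm hχ le_top).symm.symm

/-! ### Rows -/

/-- **SU(2), `d = 4`: `β_W < β_c(ℤ³ Ising) ⇒ AreaLawCentreBlind 2 4 β`** (`β_W = 2|β|`; `β_c(ℤ³) = criticalBeta 3 ≈ 0.2217` numerically — no closed form;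
rung 3 gave the explicit `β_W ≤ 0.194067`). [folklore] -/
theorem su2_areaLawCentreBlind_subcritical_dim4 {β : ℝ} (h : 2 * |β| < criticalBeta 3) : AreaLawCentreBlind 2 4 β :=
  su2_areaLawCentreBlind_of_lt_criticalBeta (n := 3) (by norm_num) h

/-- **SU(2), `d = 3`: `β_W < ½ log(1+√2) = 0.440686… ⇒ AreaLawCentreBlind 2 3 β`** (the tree's `criticalBeta_two_holds`: `β_c(ℤ²) = ½log(1+√2)`;
rung 3 gave `β_W ≤ 0.32696`, rung 2 `β_W < 0.2971`, rung 1 `β_W < 1/4`). [cite: AizenmanBarskyFernandez1987, Thm. (β_c(ℤ²) = ½ log(1+√2))] -/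
theorem su2_areaLawCentreBlind_subcritical_dim3 {β : ℝ} (h : 2 * |β| < Real.log (1 + Real.sqrt 2) / 2) : AreaLawCentreBlind 2 3 β := by
  refine su2_areaLawCentreBlind_of_lt_criticalBeta (n := 2) le_rfl ?_
  have h2 : criticalBeta 2 = criticalBetaTwo := Literature.Probability.LatticeModels.criticalBeta_two_holds
  rw [h2]
  exact h

/-- **Rung ∞ contains rung 3** (`d = 3`): the ball window `tanh β_W ≤ 6/19` (`β_W ≤ 0.32696`) lies inside `β_W < ½log(1+√2)` since `tanh(½log(1+√2)) = √2 − 1 >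
6/19`; here in the weaker but explicit form `β_W ≤ 2/5 ⇒ AreaLawCentreBlind 2 3 β` (`e^{4/5} ≤ (10/9)^8 < 1 + √2`). [folklore] -/
theorem su2_areaLawCentreBlind_subcritical_dim3_of_le {β : ℝ} (h : 2 * |β| ≤ 2 / 5) : AreaLawCentreBlind 2 3 β := by
  refine su2_areaLawCentreBlind_subcritical_dim3 (lt_of_le_of_lt h ?_)
  -- `2/5 < log(1+√2)/2 ⇔ e^{4/5} < 1 + √2`
  have hsqrt : (1.414 : ℝ) < Real.sqrt 2 := by
    rw [show (1.414 : ℝ) = Real.sqrt (1.414 ^ 2) by rw [Real.sqrt_sq (by norm_num)]]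
    exact Real.sqrt_lt_sqrt (by norm_num) (by norm_num)
  have hexp : Real.exp (4 / 5) < 1 + Real.sqrt 2 := by
    have h1 : Real.exp (4 / 5) = Real.exp (1 / 10) ^ 8 := by rw [← Real.exp_nat_mul]; norm_num
    have h2 : Real.exp (1 / 10) ≤ 10 / 9 := by
      have := Real.add_one_le_exp (-(1 / 10 : ℝ))
      rw [Real.exp_neg] at this
      have hpos := Real.exp_pos (1 / 10 : ℝ)
      rw [le_inv_comm₀ (by norm_num) hpos] at this
      · exact this.trans (by norm_num)
    have h3 : Real.exp (1 / 10) ^ 8 ≤ (10 / 9 : ℝ) ^ 8 := pow_le_pow_left₀ (Real.exp_pos _).le h2 8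
    rw [h1]
    exact h3.trans_lt (by nlinarith)
  have := (Real.lt_log_iff_exp_lt (by positivity)).2 hexp
  linarith

/-- **CELL SU(2), `d = 3`, `β_W = 2/5 = 0.4`** (beyond rung 3's `0.32696`): `AreaLawCentreBlind 2 3 (1/5)`. [folklore] -/
theorem su2_areaLawCentreBlind_subcritical_cell_dim3 : AreaLawCentreBlind 2 3 (1 / 5) :=
  su2_areaLawCentreBlind_subcritical_dim3_of_le (by rw [abs_of_pos (by norm_num)]; norm_num)

/-- **SHARP CELL SU(2), `d = 3`, `β_W = 11/25 = 0.44`** (the window ends at `β_W = ½log(1+√2) = 0.44068…`): `AreaLawCentreBlind 2 3 (11/50)`, via the Taylor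
enclosure `e^{0.88} ≤ ∑_{m<8} 0.88^m/m! + 0.88⁸·9/(8!·8) < 2.4108 < 1 + √2`. [folklore] -/
theorem su2_areaLawCentreBlind_subcritical_cell_dim3_sharp : AreaLawCentreBlind 2 3 (11 / 50) := by
  refine su2_areaLawCentreBlind_subcritical_dim3 ?_
  rw [abs_of_pos (by norm_num)]
  have hsqrt : (1.4142 : ℝ) < Real.sqrt 2 := by
    rw [show (1.4142 : ℝ) = Real.sqrt (1.4142 ^ 2) by rw [Real.sqrt_sq (by norm_num)]]
    exact Real.sqrt_lt_sqrt (by norm_num) (by norm_num)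
  have hexp : Real.exp (22 / 25) < 1 + Real.sqrt 2 := by
    have hb := Real.exp_bound' (x := (22 / 25 : ℝ)) (by norm_num) (by norm_num) (n := 8) (by norm_num)
    have hnum : (∑ m ∈ Finset.range 8, (22 / 25 : ℝ) ^ m / m.factorial) + (22 / 25 : ℝ) ^ 8 * (8 + 1) / (Nat.factorial 8 * 8) < 2.4142 := by
      simp only [Finset.sum_range_succ, Finset.sum_range_zero, Nat.factorial]
      norm_num
    push_cast at hb
    linarith
  have := (Real.lt_log_iff_exp_lt (by positivity)).2 hexp
  linarith

/-- **Rung ∞ contains rung 1 in its `tanh` form** (any `d = n + 1 ≥ 2`... stated for the box `Λ_0 = {0}`): the single-site certificate is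
`φ_{β_W}(Λ_0) = 2n·tanh β_W`, so `2n tanh(2|β|) < 1 ⇒ AreaLawCentreBlind 2 (n+1) β` (gen 7: `2n·2|β| < 1`). [folklore] -/
theorem su2_areaLawCentreBlind_of_single_site {β : ℝ} (h : 2 * (n : ℝ) * Real.tanh (2 * |β|) < 1) : AreaLawCentreBlind 2 (n + 1) β := by
  classical
  refine su2_areaLawCentreBlind_of_dctIsingPhi_lt_one (R := 0) ?_
  rw [Literature.Probability.LatticeModels.dctIsingPhi_def]
  have hbox : box n 0 = {0} := by
    ext x
    simp only [Literature.Probability.LatticeModels.mem_box, Nat.cast_zero, neg_zero, Finset.mem_singleton]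
    constructor
    · intro hx; funext i; have := hx i; simp only [Pi.zero_apply]; omega
    · rintro rfl i; simp
  rw [hbox, Finset.sum_singleton, Literature.Probability.LatticeModels.isingTwoPoint_self, mul_one, Finset.sum_const, nsmul_eq_mul]
  have hcard : (((Literature.Probability.LatticeModels.zdGraph n).neighborFinset (0 : Fin n → ℤ)).filter
      (fun y => y ∉ ({0} : Finset (Fin n → ℤ)))).card ≤ 2 * n := by
    refine (Finset.card_filter_le _ _).trans ?_
    rw [Literature.Probability.LatticeModels.card_neighborFinset_zdGraph_holds (0 : Fin n → ℤ)]
  have ht0 : 0 ≤ Real.tanh (2 * |β|) := by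
    rw [Real.tanh_eq_sinh_div_cosh]
    exact div_nonneg (Real.sinh_nonneg_iff.2 (by positivity)) (Real.cosh_pos _).le
  have hc : ((((Literature.Probability.LatticeModels.zdGraph n).neighborFinset (0 : Fin n → ℤ)).filter
      (fun y => y ∉ ({0} : Finset (Fin n → ℤ)))).card : ℝ) ≤ 2 * n := by exact_mod_cast hcard
  nlinarith

/-! ### Limit states on the subcritical window -/

/-- **STRING TENSION ON THE SUBCRITICAL WINDOW** (`SU(2)`, `d = n + 1 ≥ 3`, `2|β| < β_c(ℤⁿ)`): ONE pair `(C, c)`, `c > 0`, such that every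
infinite-volume limit state of every eventually-centre-blind family obeys `HasAreaLawWith μ χ₂ C c`, `HasAreaLawState`, `σ ≥ c` WHENEVER its string
tension exists, and `IsConfining` given existence (gen 7's `stringTension_centreBlind` on the subcritical window).  Existence of `σ` NOT asserted. [folklore] -/
theorem su2_stringTension_centreBlind_subcritical (hn : 2 ≤ n) {β : ℝ} (hβ : 2 * |β| < criticalBeta n) :
    ∃ C c : ℝ, 0 < c ∧ ∀ 𝓦 : PerturbationFamily (n + 1) 2,
      (∀ᶠ L : ℕ in Filter.atTop, IsCentreBlind (𝓦 L)) →
        ∀ μ ∈ perturbedLimitPoints β 𝓦,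
          Literature.MathematicalPhysics.QuantumLattice.HasAreaLawWith μ (fun g => Literature.MathematicalPhysics.QuantumLattice.normalisedCharacter 2 (fundamentalRep (Fin 2) g)) C c ∧
          Literature.MathematicalPhysics.QuantumLattice.HasAreaLawState μ (fun g => Literature.MathematicalPhysics.QuantumLattice.normalisedCharacter 2 (fundamentalRep (Fin 2) g)) ∧
          (∀ σ : ℝ, Literature.MathematicalPhysics.QuantumLattice.HasStringTension μ (fun g => Literature.MathematicalPhysics.QuantumLattice.normalisedCharacter 2 (fundamentalRep (Fin 2) g)) σ →
            c ≤ σ) ∧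
          ((∃ σ : ℝ, Literature.MathematicalPhysics.QuantumLattice.HasStringTension μ (fun g => Literature.MathematicalPhysics.QuantumLattice.normalisedCharacter 2 (fundamentalRep (Fin 2) g)) σ) →
            Literature.MathematicalPhysics.QuantumLattice.IsConfining μ (fun g => Literature.MathematicalPhysics.QuantumLattice.normalisedCharacter 2 (fundamentalRep (Fin 2) g))) :=
  stringTension_centreBlind (N := 2) (d := n + 1) (by omega) (su2_areaLawCentreBlind_of_lt_criticalBeta hn hβ)

/-- **SU(2), `d = 3`, `β_W = 11/25 = 0.44`**: the limit-state string-tension reading at the sharp subcritical cell. [folklore] -/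
theorem su2_stringTension_centreBlind_subcritical_cell_dim3 :
    ∃ C c : ℝ, 0 < c ∧ ∀ 𝓦 : PerturbationFamily 3 2,
      (∀ᶠ L : ℕ in Filter.atTop, IsCentreBlind (𝓦 L)) →
        ∀ μ ∈ perturbedLimitPoints (11 / 50 : ℝ) 𝓦,
          Literature.MathematicalPhysics.QuantumLattice.HasAreaLawWith μ (fun g => Literature.MathematicalPhysics.QuantumLattice.normalisedCharacter 2 (fundamentalRep (Fin 2) g)) C c ∧
          Literature.MathematicalPhysics.QuantumLattice.HasAreaLawState μ (fun g => Literature.MathematicalPhysics.QuantumLattice.normalisedCharacter 2 (fundamentalRep (Fin 2) g)) ∧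
          (∀ σ : ℝ, Literature.MathematicalPhysics.QuantumLattice.HasStringTension μ (fun g => Literature.MathematicalPhysics.QuantumLattice.normalisedCharacter 2 (fundamentalRep (Fin 2) g)) σ →
            c ≤ σ) ∧
          ((∃ σ : ℝ, Literature.MathematicalPhysics.QuantumLattice.HasStringTension μ (fun g => Literature.MathematicalPhysics.QuantumLattice.normalisedCharacter 2 (fundamentalRep (Fin 2) g)) σ) →
            Literature.MathematicalPhysics.QuantumLattice.IsConfining μ (fun g => Literature.MathematicalPhysics.QuantumLattice.normalisedCharacter 2 (fundamentalRep (Fin 2) g))) :=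
  stringTension_centreBlind (N := 2) (by norm_num) su2_areaLawCentreBlind_subcritical_cell_dim3_sharp

end Summit.Ventures.YMGap.RobustBall

end
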